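import Literature.MathematicalPhysics.QuantumFieldTheory.BalabanImbrieJaffe1984to88.BIJ88Eq5134TwoSpecies

/-!
# `BalabanImbrieJaffe1984to88.BIJ88Expansion5143` — T. Bałaban, J. Imbrie, A. Jaffe, *Effective action and cluster properties of the
abelian Higgs model*, Commun. Math. Phys. **114** (1988) 257–315 [BalabanImbrieJaffe1988], §5.14 p. 309 [PDF 53]: **display (5.14.3) — the
cluster expansion of the expectations carrying the `t`-derivative observables `(d/dt)_{γ_j}`, with its bookkeeping `H_β ⊂ H`** — DERIVED from
the polymer representation of §5.13 (this seat's `BIJ88PolymerRep5134.polymerRep`, display (5.13.4)) for SLOT-LOCAL cluster-factorizing corner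
expectations, and **the p. 309 sentence** *"If |X_β| = 1, H_β = ∅, we write g₃(∅,X_β) = 1 + g₃′(∅,X_β) and the above expansion holds again,
but without the condition that {X_β} fill Λ₁₂^{(k)}. The {X_β} must cover all cubes connected with the (d/dt)_{γ_j}, j ∈ H. Let us drop the
prime"* — PROVED as the finite identity it is (the subtractive normalization of the one-cube activities against the cover condition).

statement-level skeleton of published theorems with citation tags; proofs where landed; nothing here is a claim about the Yang–Mills mass gap

PDF held: `paper:balaban1988-cmp114-bij-abelian-higgs-effective-action` (journal page = PDF page + 256); p. 308 = PDF 52 rendered and read as an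
image this session (`renders/original-p052-x2.png` of the p25 seat), p. 309 = PDF 53 read as an image (`lit-balaban-ref-1/renders/cmp114/
original-p053-x2.png`).

**The print (verbatim).** p. 308 [PDF 52]: *"We express each d/dt as a sum Σ_γ (d/dt)_γ, where (d/dt)_γ acts only on the t before a particular
term V^{(k)}(Y) in Ṽ^{(k)} or in a particular χ-factor. We cluster expand as before each integral making up the truncated expectation values
⟨(d/dt)_{γ_1}; …; (d/dt)_{γ_{n̄+1}}⟩_t. Let H ⊂ {1, …, n̄+1} specify which observables are included in one of the integrals. If j ∈ H then we
have a factor (d/dt)_{γ_j} in the integral. The partition"* p. 309 [PDF 53]: *"{□_i} of Λ^{(k)}_{12} is determined by the sets Y from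
e^{−tV^{(k)}(Y)} − 1 factors, and by sets Y from V^{(k)}(Y) factors differentiated down. The expansion takes the form
⟨Π_{j∈H} (d/dt)_{γ_j} χ′_{Λ^{(k)}_{12},t} e^{−tṼ^{(k)}(Λ^{(k)}_{12})}⟩_{1,Λ^{(k)}_{12}} = Σ_{{X_α} filling Λ^{(k)}_{12}} Π_β g₃(H_β, X_β). (5.14.3)
Here H_β ⊂ H specifies which (d/dt)_{γ_j} have supports intersecting X_β. The polymer activity g₃ is essentially the same as g₂, but with
additional observables, namely the (d/dt)_γ-factors determined by H_β. … If |X_β| = 1, H_β = ∅, we write g₃(∅,X_β) = 1 + g₃′(∅,X_β) and the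
above expansion holds again, but without the condition that {X_β} fill Λ^{(k)}_{12}. The {X_β} must cover all cubes connected with the
(d/dt)_{γ_j}, j ∈ H. Let us drop the prime, … Returning to our expansion, let us sum first over {H_γ}, the partition of H determined by the
{X_β}."*

WHAT IS REPRODUCED (unit `lit-balaban-p25`, generation 10 of the Phase-2 proof seat p25; SKELETON row `C2.Eq5.14.3-5.14.4` of
`HOME/lit-balaban-r16/ROWS-C2-part2.md`, whose cell recorded *"(5.14.3) display proper … still untyped"*; HOME `run/shared/lean/pub/lit-balaban/`).
Setting of this seat's gen-8/9 files (`BIJ88Clusters5134`, `BIJ88PolymerRep5134`): cubes `ι` with the abutting relation `adj`, corner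
expectations `z X Λ = ⟨Π_{i∈X} f(□_i)⟩_{1_Λ,X}` over the fields of a region `X` at the parameter corner `1_Λ`, the printed activities
`g1 adj z X`, the fillings of `W` = its set partitions, ADMISSIBLE ones = cluster configurations (`IsAdmissible`). NEW: a type `S` of DERIVATIVE
SLOTS `j` (the `j ∈ H` of the print, each carrying one `(d/dt)_{γ_j}`) with the cube `loc j` supporting `(d/dt)_{γ_j}` (*"(d/dt)_γ acts only on
the t before a particular term … or in a particular χ-factor"*), and corner data `z K` DEPENDING ON THE SLOT SET `K ⊆ H` put into the integrand.
* §1 `slotsIn loc K X` = **`H_β`**: *"H_β ⊂ H specifies which (d/dt)_{γ_j} have supports intersecting X_β"* (`= {j ∈ K : loc j ∈ X}`); its algebra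
  (`slotsIn_slotsIn`, `disjoint_slotsIn`, `biUnion_slotsIn`) and **`isSetPartition_image_slotsIn`**: over a filling the nonempty `H_β` form *"the
  partition of H determined by the {X_β}"* (p. 309).
* §2 **(5.14.3)**: `IsSlotLocal loc z` (*"⟨·⟩_{s_Γ,X} is defined by integrating over the fields in X only"*, p. 306, for the slots: the expectation over
  the fields of `X` sees only the derivative factors located in `X`, `z K X Λ = z (slotsIn loc K X) X Λ`), the activity **`g3 adj z H X := g1 adj (z H) X`**
  (*"g₃ is essentially the same as g₂, but with additional observables, namely the (d/dt)_γ-factors determined by H_β"*), `g1_eq_g3`, and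
  **`expansion5143`**: for slot-local `z` with `z K` cluster-factorizing, `z K W W = Σ_{P admissible filling of W} Π_{X∈P} g3 adj z (slotsIn loc K X) X`
  — DISPLAY (5.14.3) with the fillings read as cluster configurations (this seat's READING NOTE GAPS.md G-C2-p25-03, kernel-checked in
  `BIJ88PolymerRep5134`: with the paper's cube-wise interpolation the {X_α} of (5.13.4)/(5.14.3) are cluster configurations).
* §3 **DROP THE PRIME**: `prime g H X := g H X − 𝟙[H = ∅ ∧ |X| = 1]` (the printed `g₃′`), the nonoverlapping families `nonoverlapping W`, the cover
  condition `Covers loc K F` (*"The {X_β} must cover all cubes connected with the (d/dt)_{γ_j}, j ∈ H"*), and **`dropPrime`**: for every activity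
  `g : Finset S → Finset ι → R` and every constraint `C` on families that is blind to one-cube polymers (`hC`; e.g. admissibility, or none),
  `Σ_{P filling W, C P} Π_{X∈P} g(H(X),X) = Σ_{F nonoverlapping, C F, F covers loc K} Π_{X∈F} prime g (H(X)) X` — the bijection `(P, T) ↦ (P ∖ E(P)) ∪ T`,
  `E(P)` = the one-cube blocks of `P` carrying no slot, `T ⊆ E(P)` (expanding `Π_{E(P)}(1 + g₃′)`), inverse `F ↦ (F ∪ {{c} : c uncovered}, E(F))`;
  corollaries `dropPrime_admissible`, `dropPrime_all`, and **`expansion5143_dropPrime`** (`z K W W` = the prime-dropped covering expansion).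
The sum over the Mayer data `S` (the □_i depend on `S`, p. 309 first lines) is exchanged exactly as for (5.13.4) (`BIJ88Eq5134TwoSpecies.eq5134_right`,
`K` a parameter of the weights): `expansion5143_twoSpecies` (§5); the prime-dropped form of (5.14.3) is `expansion5143_dropPrime` (§4).
* §6 (v1.1, theorem-only append) **COVER AND CONNECT** (p. 309: *"Each X_γ must cover and connect all the t-derivatives specified by H_γ"*):
  `g3_eq_zero_of_not_isConn` (`g₃(H,X) = 0` on disconnected polymers of ≥ 2 cubes, from `BIJ88PolymerRep5134.g1_of_two_le`), the same prime-dropped,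
  `expansion5143_conn` / `expansion5143_dropPrime_conn` ((5.14.3) and its prime-dropped form over families of CONNECTED polymers); the `X_β∖H_β` of
  (5.14.4) (`sdiff_image_slotsIn`: `X ∖ loc(H_β) = X ∖ loc(K)`) and `Σ_β|H_β| = |K|` over fillings / covering families (`sum_card_slotsIn(_of_covers)`).

**Honest scope / readings.** (a) As in gen 8: *"{X_α} filling Λ₁₂"* = cluster configurations (admissible set partitions); the all-set-partitions
reading over-counts (`BIJ88PolymerRep5134.sum_setPartitions_eq`). (b) `loc j` is ONE cube (the print's *"supports intersecting X_β"* allows a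
support meeting several cubes; a `V^{(k)}(Y)`-term differentiated down has support `Y`, which rule (i) of p. 304 places inside one elementary
region — at the level of elementary regions the support is one region; this file works at that level, `ι` = regions, as gen 8). (c) The slots
located outside `W` carry no factor in `W` (hypothesis `hK : ∀ j ∈ K, loc j ∈ W` where the cover condition is stated). (d) Nothing analytic:
`t`, `γ`, the fields are parameters of `z`; (5.14.4) (the bound) is the typed leaf `BIJ88Sect5StatementsPart2.Ineq5144`, not asserted; the link of
the prime-dropped ORDERED form with gen 6's `BIJ88ConnectedGraphResummation.Nsum` is the separate file `BIJ88Expansion5143Ordered`. 0 `sorry`, 0 new `Prop` facts, finite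
identities over a commutative ring; imports `BIJ88Eq5134TwoSpecies` only (for `g1_congr`, `eq5134_right`); modifies nothing. NOT summit progress;
NOT continuum; NOT Clay. Cell `lit-balaban` Phase 2, seat p25 gen 10 (v1 p308825; v1.1 = §6 appended, no statement of v1 touched); row C2.Eq5.14.3-5.14.4 (owner r16, referee ref-5).
-/

open Finset
open Literature.Probability.LatticeModels (IsSetPartition setPartitions mem_setPartitions)
open Literature.MathematicalPhysics.QuantumFieldTheory.BalabanImbrieJaffe1984to88.BIJ88Clusters5134
open Literature.MathematicalPhysics.QuantumFieldTheory.BalabanImbrieJaffe1984to88.BIJ88PolymerRep5134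
open Literature.MathematicalPhysics.QuantumFieldTheory.BalabanImbrieJaffe1984to88.BIJ88ElementaryRegions304 (regions IsClosed isSetPartition_regions)
open Literature.MathematicalPhysics.QuantumFieldTheory.BalabanImbrieJaffe1984to88.BIJ88Resummation5141 (polysIn restrictTo)
open Literature.MathematicalPhysics.QuantumFieldTheory.BalabanImbrieJaffe1984to88.BIJ88MayerExchange5134 (radj HardCore localI gA gB)
open Literature.MathematicalPhysics.QuantumFieldTheory.BalabanImbrieJaffe1984to88.BIJ88Eq5134TwoSpecies (g1_congr eq5134_right)

namespace Literature.MathematicalPhysics.QuantumFieldTheory.BalabanImbrieJaffe1984to88.BIJ88Expansion5143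

variable {ι : Type*} [DecidableEq ι] {S : Type*}

/-! ## §1 `H_β ⊂ H`: the derivative slots located in a polymer -/

section Slots

variable (loc : S → ι) (K : Finset S)

/-- **`H_β`** — p. 309 [PDF 53], verbatim: *"Here H_β ⊂ H specifies which (d/dt)_{γ_j} have supports intersecting X_β"*: the slots `j ∈ K` whose
supporting cube `loc j` lies in `X`. [cite: BalabanImbrieJaffe1988, (5.14.3) p.309] -/
def slotsIn (X : Finset ι) : Finset S := K.filter fun j => loc j ∈ X

variable {loc K}

/-- membership in `H_β`. [cite: BalabanImbrieJaffe1988, (5.14.3) p.309] -/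
theorem mem_slotsIn {X : Finset ι} {j : S} : j ∈ slotsIn loc K X ↔ j ∈ K ∧ loc j ∈ X := mem_filter

/-- `H_β ⊆ H`. [cite: BalabanImbrieJaffe1988, (5.14.3) p.309] -/
theorem slotsIn_subset (X : Finset ι) : slotsIn loc K X ⊆ K := filter_subset _ _

/-- monotone in the polymer. [cite: BalabanImbrieJaffe1988, (5.14.3) p.309] -/
theorem slotsIn_mono {X Y : Finset ι} (h : X ⊆ Y) : slotsIn loc K X ⊆ slotsIn loc K Y := fun j hj => by
  rw [mem_slotsIn] at hj ⊢
  exact ⟨hj.1, h hj.2⟩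

/-- no polymer, no slot. [cite: BalabanImbrieJaffe1988, (5.14.3) p.309] -/
@[simp] theorem slotsIn_empty : slotsIn loc K (∅ : Finset ι) = ∅ :=
  filter_false_of_mem fun j _ => notMem_empty (loc j)

/-- the slots of a sub-polymer are the slots of the polymer located in it. [cite: BalabanImbrieJaffe1988, (5.14.3) p.309] -/
theorem slotsIn_slotsIn {X Y : Finset ι} (h : X ⊆ Y) : slotsIn loc (slotsIn loc K Y) X = slotsIn loc K X := by
  ext j
  simp only [mem_slotsIn]
  exact ⟨fun hj => ⟨hj.1.1, hj.2⟩, fun hj => ⟨⟨hj.1, h hj.2⟩, hj.2⟩⟩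

/-- the slots of a polymer inside `X` computed from `K` or from `H(X)` agree. [cite: BalabanImbrieJaffe1988, (5.14.3) p.309] -/
theorem slotsIn_slotsIn_self (X : Finset ι) : slotsIn loc (slotsIn loc K X) X = slotsIn loc K X := slotsIn_slotsIn Subset.rfl

/-- disjoint polymers carry disjoint slot sets (*"no duplication of t-derivatives"*, p. 310). [cite: BalabanImbrieJaffe1988, (5.14.3) p.309] -/
theorem disjoint_slotsIn {X Y : Finset ι} (h : Disjoint X Y) : Disjoint (slotsIn loc K X) (slotsIn loc K Y) :=
  disjoint_left.2 fun _ hjX hjY => disjoint_left.1 h (mem_slotsIn.1 hjX).2 (mem_slotsIn.1 hjY).2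

/-- a one-cube polymer `{c}` carries no slot iff no slot is located at `c`. [cite: BalabanImbrieJaffe1988, (5.14.3) p.309] -/
theorem slotsIn_singleton_eq_empty_iff {c : ι} : slotsIn loc K {c} = ∅ ↔ ∀ j ∈ K, loc j ≠ c := by
  simp only [slotsIn, filter_eq_empty_iff, mem_singleton]

variable [DecidableEq S]

/-- over a family of polymers, the union of the `H_β` is the slot set of the union. [cite: BalabanImbrieJaffe1988, (5.14.3) p.309] -/
theorem biUnion_slotsIn (P : Finset (Finset ι)) : P.biUnion (slotsIn loc K) = slotsIn loc K (P.biUnion id) := by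
  ext j
  simp only [mem_biUnion, mem_slotsIn, id]
  constructor
  · rintro ⟨X, hX, hjK, hjX⟩
    exact ⟨hjK, X, hX, hjX⟩
  · rintro ⟨hjK, X, hX, hjX⟩
    exact ⟨X, hX, hjK, hjX⟩

/-- over a filling of `W`, the union of the `H_β` is the set of slots located in `W`. [cite: BalabanImbrieJaffe1988, (5.14.3) p.309] -/
theorem biUnion_slotsIn_of_isSetPartition {W : Finset ι} {P : Finset (Finset ι)} (hP : IsSetPartition W P) :
    P.biUnion (slotsIn loc K) = slotsIn loc K W := by
  rw [biUnion_slotsIn, hP.biUnion_id]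

/-- **"the partition of H determined by the {X_β}"** (p. 309: *"let us sum first over {H_γ}, the partition of H determined by the {X_β}. Denote
the X_β's with H_β ≠ ∅ by X_γ"*): over a filling `P` of `W`, the nonempty slot sets `H_β = slotsIn loc K X_β`, `X_β ∈ P`, form a set partition of
the slots located in `W`. [cite: BalabanImbrieJaffe1988, p.309 (Sect. 5.14)] -/
theorem isSetPartition_image_slotsIn {W : Finset ι} {P : Finset (Finset ι)} (hP : IsSetPartition W P) :
    IsSetPartition (slotsIn loc K W) ((P.image (slotsIn loc K)).filter fun H => H.Nonempty) := by
  refine ⟨fun H hH => ?_, fun h => ?_, fun j hj => ?_, fun H hH H' hH' j hjH hjH' => ?_⟩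
  · obtain ⟨hH, -⟩ := mem_filter.1 hH
    obtain ⟨X, hX, rfl⟩ := mem_image.1 hH
    exact slotsIn_mono (hP.subset hX)
  · exact (not_nonempty_empty (mem_filter.1 h).2).elim
  · obtain ⟨hjK, hjW⟩ := mem_slotsIn.1 hj
    obtain ⟨X, hX, hjX⟩ := hP.exists_mem hjW
    exact ⟨slotsIn loc K X, mem_filter.2 ⟨mem_image_of_mem _ hX, ⟨j, mem_slotsIn.2 ⟨hjK, hjX⟩⟩⟩, mem_slotsIn.2 ⟨hjK, hjX⟩⟩
  · obtain ⟨hH, -⟩ := mem_filter.1 hH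
    obtain ⟨hH', -⟩ := mem_filter.1 hH'
    obtain ⟨X, hX, rfl⟩ := mem_image.1 hH
    obtain ⟨X', hX', rfl⟩ := mem_image.1 hH'
    rw [hP.eq_of_mem hX hX' (mem_slotsIn.1 hjH).2 (mem_slotsIn.1 hjH').2]

end Slots

/-! ## §2 Display (5.14.3): the polymer representation with the `(d/dt)_γ`-observables, `H_β` determined by `X_β` -/

section Display

variable (adj : ι → ι → Prop) [DecidableRel adj] {R : Type*} [CommRing R] (loc : S → ι)

/-- **SLOT-LOCALITY of the corner expectations** (p. 306 [PDF 50]: *"⟨·⟩_{s_Γ,X} is defined by integrating over the fields in X only"*, read for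
the derivative observables of p. 308: *"(d/dt)_γ acts only on the t before a particular term V^{(k)}(Y) in Ṽ^{(k)} or in a particular χ-factor"*):
the expectation `z K X Λ = ⟨Π_{j∈K}(d/dt)_{γ_j} Π_{i∈X} f(□_i)⟩_{1_Λ,X}` over the fields of `X` with the slots `K` put into the integrand sees only the
slots located in `X`. [cite: BalabanImbrieJaffe1988, (5.14.3) p.309] -/
def IsSlotLocal (z : Finset S → Finset ι → Finset ι → R) : Prop :=
  ∀ K X Λ, Λ ⊆ X → z K X Λ = z (slotsIn loc K X) X Λ

/-- **the polymer activity `g₃(H, X)`** (p. 309 [PDF 53]: *"The polymer activity g₃ is essentially the same as g₂, but with additional observables,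
namely the (d/dt)_γ-factors determined by H_β"*): the printed activity `g₁` of `BIJ88PolymerRep5134` (p. 306, in corner form) of the corner data
carrying the slot set `H`. [cite: BalabanImbrieJaffe1988, (5.14.3) p.309] -/
def g3 (z : Finset S → Finset ι → Finset ι → R) (H : Finset S) (X : Finset ι) : R := g1 adj (z H) X

variable {adj loc}

/-- for slot-local data, the activity of a polymer `X` computed with all slots `K` is `g₃(H(X), X)`. [cite: BalabanImbrieJaffe1988, (5.14.3) p.309] -/
theorem g1_eq_g3 {z : Finset S → Finset ι → Finset ι → R} (hloc : IsSlotLocal loc z) (K : Finset S) (X : Finset ι) :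
    g1 adj (z K) X = g3 adj z (slotsIn loc K X) X :=
  g1_congr adj fun Λ hΛ => hloc K X Λ hΛ

/-- `g₃(H, X)` depends on `H` only through the slots located in `X`. [cite: BalabanImbrieJaffe1988, (5.14.3) p.309] -/
theorem g3_slotsIn {z : Finset S → Finset ι → Finset ι → R} (hloc : IsSlotLocal loc z) (H : Finset S) (X : Finset ι) :
    g3 adj z H X = g3 adj z (slotsIn loc H X) X :=
  g1_eq_g3 hloc H X

/-- **DISPLAY (5.14.3)** (p. 309 [PDF 53], verbatim: *"⟨Π_{j∈H} (d/dt)_{γ_j} χ′_{Λ^{(k)}_{12},t} e^{−tṼ^{(k)}(Λ^{(k)}_{12})}⟩_{1,Λ^{(k)}_{12}} =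
Σ_{{X_α} filling Λ^{(k)}_{12}} Π_β g₃(H_β, X_β). (5.14.3) Here H_β ⊂ H specifies which (d/dt)_{γ_j} have supports intersecting X_β"*) — DERIVED: for a
family of corner expectations `z K` indexed by the slot sets put into the integrand, cluster-factorizing for the slot set `K` (the p. 306
factorization, `BIJ88Clusters5134.IsClusterFactorizing`) and slot-local, the expectation `z K W W = ⟨Π_{j∈K}(d/dt)_{γ_j} Π_{i∈W} f(□_i)⟩_1` is the sum
over the fillings `{X_β}` of `W` (cluster configurations, `IsAdmissible`) of `Π_β g₃(H_β, X_β)` with `H_β = slotsIn loc K X_β` — by the polymer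
representation (5.13.4) (`BIJ88PolymerRep5134.polymerRep`, *"We cluster expand as before"*) and slot-locality. [cite: BalabanImbrieJaffe1988, (5.14.3) p.309] -/
theorem expansion5143 {z : Finset S → Finset ι → Finset ι → R} {K : Finset S} (hz : IsClusterFactorizing adj (z K))
    (hloc : IsSlotLocal loc z) (W : Finset ι) :
    z K W W = ∑ P ∈ (setPartitions W).filter (IsAdmissible adj), ∏ X ∈ P, g3 adj z (slotsIn loc K X) X := by
  rw [polymerRep hz W]
  exact sum_congr rfl fun P _ => prod_congr rfl fun X _ => g1_eq_g3 hloc K X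

/-- (5.14.3) over ALL set partitions differs from the expectation by the inadmissible fillings (as for (5.13.4),
`BIJ88PolymerRep5134.sum_setPartitions_eq`). [cite: BalabanImbrieJaffe1988, (5.14.3) p.309] -/
theorem sum_setPartitions_g3_eq {z : Finset S → Finset ι → Finset ι → R} {K : Finset S} (hz : IsClusterFactorizing adj (z K))
    (hloc : IsSlotLocal loc z) (W : Finset ι) :
    ∑ P ∈ setPartitions W, ∏ X ∈ P, g3 adj z (slotsIn loc K X) X =
      z K W W + ∑ P ∈ (setPartitions W).filter (fun P => ¬ IsAdmissible adj P), ∏ X ∈ P, g3 adj z (slotsIn loc K X) X := by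
  rw [expansion5143 hz hloc W, sum_filter_add_sum_filter_not]

/-- no slots: `g₃(∅, X)` is the plain activity `g₁` of the slot-free data (*"essentially the same as g₂"*), and (5.14.3) at `K = ∅` is (5.13.4).
[cite: BalabanImbrieJaffe1988, (5.14.3) p.309] -/
theorem g3_empty (z : Finset S → Finset ι → Finset ι → R) (X : Finset ι) : g3 adj z ∅ X = g1 adj (z ∅) X := rfl

end Display

/-! ## §3 *"we write g₃(∅,X_β) = 1 + g₃′(∅,X_β) … without the condition that {X_β} fill Λ₁₂ … must cover … Let us drop the prime"* -/

section DropPrime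

variable [DecidableEq S] {R : Type*} [CommRing R] (loc : S → ι) (K : Finset S)

/-- **`g₃′`** (p. 309: *"If |X_β| = 1, H_β = ∅, we write g₃(∅,X_β) = 1 + g₃′(∅,X_β)"*): subtract `1` from the activity of a one-cube polymer
carrying no slot; all other activities unchanged. [cite: BalabanImbrieJaffe1988, p.309 (Sect. 5.14)] -/
def prime (g : Finset S → Finset ι → R) (H : Finset S) (X : Finset ι) : R :=
  g H X - if H = ∅ ∧ X.card = 1 then 1 else 0

omit [DecidableEq ι] in
/-- off the one-cube slot-free polymers the prime changes nothing. [cite: BalabanImbrieJaffe1988, p.309 (Sect. 5.14)] -/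
theorem prime_of_not (g : Finset S → Finset ι → R) {H : Finset S} {X : Finset ι} (h : ¬ (H = ∅ ∧ X.card = 1)) :
    prime g H X = g H X := by
  rw [prime, if_neg h, sub_zero]

omit [DecidableEq ι] in
/-- on a one-cube slot-free polymer `g₃ = 1 + g₃′`. [cite: BalabanImbrieJaffe1988, p.309 (Sect. 5.14)] -/
theorem eq_one_add_prime (g : Finset S → Finset ι → R) {H : Finset S} {X : Finset ι} (h : H = ∅ ∧ X.card = 1) :
    g H X = 1 + prime g H X := by
  rw [prime, if_pos h]
  ring

/-- **nonoverlapping families** of polymers in `W` (*"{X_γ}, {Y_δ} nonoverlapping"*, p. 309): families of pairwise disjoint nonempty sets of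
cubes of `W`. [cite: BalabanImbrieJaffe1988, p.309 (Sect. 5.14)] -/
def nonoverlapping (W : Finset ι) : Finset (Finset (Finset ι)) :=
  (W.powerset.filter fun X => X.Nonempty).powerset.filter fun F => ∀ X ∈ F, ∀ Y ∈ F, X ≠ Y → Disjoint X Y

/-- **the cover condition** (p. 309: *"The {X_β} must cover all cubes connected with the (d/dt)_{γ_j}, j ∈ H"*): every slot of `K` is located in
some polymer of the family. [cite: BalabanImbrieJaffe1988, p.309 (Sect. 5.14)] -/
def Covers (F : Finset (Finset ι)) : Prop := ∀ j ∈ K, ∃ X ∈ F, loc j ∈ X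

/-- decidability of the cover condition. [cite: BalabanImbrieJaffe1988, p.309 (Sect. 5.14)] -/
instance instDecidableCovers (F : Finset (Finset ι)) : Decidable (Covers loc K F) :=
  inferInstanceAs (Decidable (∀ j ∈ K, ∃ X ∈ F, loc j ∈ X))

variable {loc K}

/-- membership in `nonoverlapping`. [cite: BalabanImbrieJaffe1988, p.309 (Sect. 5.14)] -/
theorem mem_nonoverlapping {W : Finset ι} {F : Finset (Finset ι)} :
    F ∈ nonoverlapping W ↔ (∀ X ∈ F, X ⊆ W ∧ X.Nonempty) ∧ ∀ X ∈ F, ∀ Y ∈ F, X ≠ Y → Disjoint X Y := by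
  simp only [nonoverlapping, mem_filter, mem_powerset, subset_iff]

/-- a filling is a nonoverlapping family. [cite: BalabanImbrieJaffe1988, p.309 (Sect. 5.14)] -/
theorem mem_nonoverlapping_of_isSetPartition {W : Finset ι} {P : Finset (Finset ι)} (hP : IsSetPartition W P) : P ∈ nonoverlapping W :=
  mem_nonoverlapping.2 ⟨fun _ hX => ⟨hP.subset hX, hP.nonempty_of_mem hX⟩, fun _ hX _ hY hne => hP.disjoint hX hY hne⟩

/-- a sub-family of a nonoverlapping family is nonoverlapping. [cite: BalabanImbrieJaffe1988, p.309 (Sect. 5.14)] -/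
theorem mem_nonoverlapping_of_subset {W : Finset ι} {F G : Finset (Finset ι)} (hG : G ∈ nonoverlapping W) (h : F ⊆ G) :
    F ∈ nonoverlapping W := by
  rw [mem_nonoverlapping] at hG ⊢
  exact ⟨fun X hX => hG.1 X (h hX), fun X hX Y hY => hG.2 X (h hX) Y (h hY)⟩

/-- **the expandable blocks** `E(P)`: the one-cube polymers of the family carrying no slot (those with `g₃ = 1 + g₃′`).
[cite: BalabanImbrieJaffe1988, p.309 (Sect. 5.14)] -/
def esing (loc : S → ι) (K : Finset S) (F : Finset (Finset ι)) : Finset (Finset ι) :=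
  F.filter fun X => X.card = 1 ∧ slotsIn loc K X = ∅

/-- **the uncovered cubes** of a family in `W`. [cite: BalabanImbrieJaffe1988, p.309 (Sect. 5.14)] -/
def uncovered (W : Finset ι) (F : Finset (Finset ι)) : Finset ι := W \ F.biUnion id

/-- **filling up** a nonoverlapping family by the one-cube polymers on its uncovered cubes. [cite: BalabanImbrieJaffe1988, p.309 (Sect. 5.14)] -/
def fill (W : Finset ι) (F : Finset (Finset ι)) : Finset (Finset ι) := F ∪ (uncovered W F).image fun c => ({c} : Finset ι)

/-- membership in `esing`. [cite: BalabanImbrieJaffe1988, p.309 (Sect. 5.14)] -/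
theorem mem_esing {F : Finset (Finset ι)} {X : Finset ι} : X ∈ esing loc K F ↔ X ∈ F ∧ X.card = 1 ∧ slotsIn loc K X = ∅ := mem_filter

/-- `E(F) ⊆ F`. [cite: BalabanImbrieJaffe1988, p.309 (Sect. 5.14)] -/
theorem esing_subset (F : Finset (Finset ι)) : esing loc K F ⊆ F := filter_subset _ _

/-- `E` is monotone. [cite: BalabanImbrieJaffe1988, p.309 (Sect. 5.14)] -/
theorem esing_mono {F G : Finset (Finset ι)} (h : F ⊆ G) : esing loc K F ⊆ esing loc K G := filter_subset_filter _ h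

/-- `E` distributes over unions. [cite: BalabanImbrieJaffe1988, p.309 (Sect. 5.14)] -/
theorem esing_union (F G : Finset (Finset ι)) : esing loc K (F ∪ G) = esing loc K F ∪ esing loc K G := filter_union _ _ _

/-- `E(F ∖ E(F)) = ∅`. [cite: BalabanImbrieJaffe1988, p.309 (Sect. 5.14)] -/
theorem esing_sdiff_esing (F : Finset (Finset ι)) : esing loc K (F \ esing loc K F) = ∅ := by
  refine filter_false_of_mem fun X hX h => ?_
  exact (mem_sdiff.1 hX).2 (mem_esing.2 ⟨(mem_sdiff.1 hX).1, h⟩)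

/-- `E(T) = T` for `T ⊆ E(F)`. [cite: BalabanImbrieJaffe1988, p.309 (Sect. 5.14)] -/
theorem esing_of_subset_esing {F T : Finset (Finset ι)} (h : T ⊆ esing loc K F) : esing loc K T = T :=
  filter_true_of_mem fun _ hX => (mem_esing.1 (h hX)).2

/-- membership in `uncovered`. [cite: BalabanImbrieJaffe1988, p.309 (Sect. 5.14)] -/
theorem mem_uncovered {W : Finset ι} {F : Finset (Finset ι)} {c : ι} : c ∈ uncovered W F ↔ c ∈ W ∧ ∀ X ∈ F, c ∉ X := by
  simp only [uncovered, mem_sdiff, mem_biUnion, id, not_exists, not_and]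

/-- membership in `fill`. [cite: BalabanImbrieJaffe1988, p.309 (Sect. 5.14)] -/
theorem mem_fill {W : Finset ι} {F : Finset (Finset ι)} {X : Finset ι} :
    X ∈ fill W F ↔ X ∈ F ∨ ∃ c ∈ uncovered W F, X = {c} := by
  simp only [fill, mem_union, mem_image, eq_comm]

/-- `F ⊆ fill F`. [cite: BalabanImbrieJaffe1988, p.309 (Sect. 5.14)] -/
theorem subset_fill (W : Finset ι) (F : Finset (Finset ι)) : F ⊆ fill W F := subset_union_left

/-- **filling up a covering nonoverlapping family gives a filling.** [cite: BalabanImbrieJaffe1988, p.309 (Sect. 5.14)] -/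
theorem isSetPartition_fill {W : Finset ι} {F : Finset (Finset ι)} (hF : F ∈ nonoverlapping W) : IsSetPartition W (fill W F) := by
  obtain ⟨hsub, hdisj⟩ := mem_nonoverlapping.1 hF
  refine ⟨fun X hX => ?_, fun h => ?_, fun c hc => ?_, fun X hX Y hY c hcX hcY => ?_⟩
  · rcases mem_fill.1 hX with hX | ⟨c, hc, rfl⟩
    · exact (hsub X hX).1
    · exact singleton_subset_iff.2 (mem_uncovered.1 hc).1
  · rcases mem_fill.1 h with h | ⟨c, -, hc⟩
    · exact (hsub ∅ h).2.ne_empty rfl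
    · exact (singleton_ne_empty c) hc.symm
  · by_cases h : ∃ X ∈ F, c ∈ X
    · obtain ⟨X, hX, hcX⟩ := h
      exact ⟨X, subset_fill W F hX, hcX⟩
    · refine ⟨{c}, mem_fill.2 (Or.inr ⟨c, mem_uncovered.2 ⟨hc, fun X hX hcX => h ⟨X, hX, hcX⟩⟩, rfl⟩), mem_singleton_self c⟩
  · rcases mem_fill.1 hX with hX | ⟨a, ha, rfl⟩ <;> rcases mem_fill.1 hY with hY | ⟨b, hb, rfl⟩
    · by_contra hne
      exact disjoint_left.1 (hdisj X hX Y hY hne) hcX hcY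
    · exact ((mem_uncovered.1 hb).2 X hX (by rwa [mem_singleton.1 hcY] at hcX)).elim
    · exact ((mem_uncovered.1 ha).2 Y hY (by rwa [mem_singleton.1 hcX] at hcY)).elim
    · rw [← mem_singleton.1 hcX, ← mem_singleton.1 hcY]

/-- the cubes not covered by a filling: none. [cite: BalabanImbrieJaffe1988, p.309 (Sect. 5.14)] -/
theorem uncovered_eq_empty_of_isSetPartition {W : Finset ι} {P : Finset (Finset ι)} (hP : IsSetPartition W P) : uncovered W P = ∅ := by
  rw [uncovered, hP.biUnion_id, sdiff_self]
  rfl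

/-- **the expandable blocks of the filled-up family**: those of `F` together with the added one-cube polymers, PROVIDED `F` covers the slots
(an uncovered cube carries no slot). [cite: BalabanImbrieJaffe1988, p.309 (Sect. 5.14)] -/
theorem esing_fill {W : Finset ι} {F : Finset (Finset ι)} (hcov : Covers loc K F) :
    esing loc K (fill W F) = esing loc K F ∪ (uncovered W F).image fun c => ({c} : Finset ι) := by
  rw [fill, esing_union]
  congr 1
  refine filter_true_of_mem fun X hX => ?_
  obtain ⟨c, hc, rfl⟩ := mem_image.1 hX
  refine ⟨card_singleton c, slotsIn_singleton_eq_empty_iff.2 fun j hj hjc => ?_⟩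
  obtain ⟨Y, hY, hjY⟩ := hcov j hj
  exact (mem_uncovered.1 hc).2 Y hY (hjc ▸ hjY)

/-- the blocks of a filling off a sub-family `T` of its expandable blocks: removing `E(P) ∖ T` leaves `(P ∖ E(P)) ∪ T`.
[cite: BalabanImbrieJaffe1988, p.309 (Sect. 5.14)] -/
theorem sdiff_esing_union {P T : Finset (Finset ι)} (hT : T ⊆ esing loc K P) : P \ esing loc K P ∪ T = P \ (esing loc K P \ T) := by
  ext X
  simp only [mem_union, mem_sdiff]
  constructor
  · rintro (⟨hXP, hXE⟩ | hXT)
    · exact ⟨hXP, fun h => hXE h.1⟩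
    · exact ⟨esing_subset P (hT hXT), fun h => h.2 hXT⟩
  · rintro ⟨hXP, h⟩
    by_cases hXE : X ∈ esing loc K P
    · exact Or.inr (by_contra fun hXT => h ⟨hXE, hXT⟩)
    · exact Or.inl ⟨hXP, hXE⟩

/-- **the uncovered cubes of `(P ∖ E(P)) ∪ T`** for a filling `P`: the cubes of the removed one-cube blocks `E(P) ∖ T`.
[cite: BalabanImbrieJaffe1988, p.309 (Sect. 5.14)] -/
theorem uncovered_sdiff_esing_union {W : Finset ι} {P T : Finset (Finset ι)} (hP : IsSetPartition W P) (hT : T ⊆ esing loc K P) :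
    uncovered W (P \ esing loc K P ∪ T) = (esing loc K P \ T).biUnion id := by
  ext c
  rw [mem_uncovered, mem_biUnion]
  constructor
  · rintro ⟨hcW, hc⟩
    obtain ⟨X, hXP, hcX⟩ := hP.exists_mem hcW
    have hX : X ∈ esing loc K P \ T := by
      rw [sdiff_esing_union hT] at hc
      by_contra hX
      exact hc X (mem_sdiff.2 ⟨hXP, hX⟩) hcX
    exact ⟨X, hX, hcX⟩
  · rintro ⟨X, hX, hcX⟩
    obtain ⟨hXE, hXT⟩ := mem_sdiff.1 hX
    have hXP : X ∈ P := esing_subset P hXE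
    refine ⟨hP.subset hXP hcX, fun Y hY hcY => ?_⟩
    rw [sdiff_esing_union hT, mem_sdiff] at hY
    have hYX : Y = X := hP.eq_of_mem hY.1 hXP hcY hcX
    subst hYX
    exact hY.2 (mem_sdiff.2 ⟨hXE, hXT⟩)

/-- the one-cube blocks of `E(P) ∖ T`, as singletons of their cubes. [cite: BalabanImbrieJaffe1988, p.309 (Sect. 5.14)] -/
theorem image_singleton_biUnion_esing {P T : Finset (Finset ι)} :
    ((esing loc K P \ T).biUnion id).image (fun c => ({c} : Finset ι)) = esing loc K P \ T := by
  ext X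
  simp only [mem_image, mem_biUnion, id, mem_sdiff]
  constructor
  · rintro ⟨c, ⟨Y, ⟨hYE, hYT⟩, hcY⟩, rfl⟩
    obtain ⟨d, hd⟩ := card_eq_one.1 (mem_esing.1 hYE).2.1
    subst hd
    rw [mem_singleton.1 hcY]
    exact ⟨hYE, hYT⟩
  · rintro ⟨hXE, hXT⟩
    obtain ⟨d, hd⟩ := card_eq_one.1 (mem_esing.1 hXE).2.1
    subst hd
    exact ⟨d, ⟨{d}, ⟨hXE, hXT⟩, mem_singleton_self d⟩, rfl⟩

/-- **filling up `(P ∖ E(P)) ∪ T` gives back `P`.** [cite: BalabanImbrieJaffe1988, p.309 (Sect. 5.14)] -/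
theorem fill_sdiff_esing_union {W : Finset ι} {P T : Finset (Finset ι)} (hP : IsSetPartition W P) (hT : T ⊆ esing loc K P) :
    fill W (P \ esing loc K P ∪ T) = P := by
  rw [fill, uncovered_sdiff_esing_union hP hT, image_singleton_biUnion_esing, sdiff_esing_union hT,
    sdiff_union_of_subset ((sdiff_subset).trans (esing_subset P))]

/-- **`E((P ∖ E(P)) ∪ T) = T`.** [cite: BalabanImbrieJaffe1988, p.309 (Sect. 5.14)] -/
theorem esing_sdiff_esing_union {P T : Finset (Finset ι)} (hT : T ⊆ esing loc K P) : esing loc K (P \ esing loc K P ∪ T) = T := by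
  rw [esing_union, esing_sdiff_esing, empty_union, esing_of_subset_esing hT]

/-- **`(fill F ∖ E(fill F)) ∪ E(F) = F`** for a covering nonoverlapping family. [cite: BalabanImbrieJaffe1988, p.309 (Sect. 5.14)] -/
theorem fill_sdiff_esing_fill_union {W : Finset ι} {F : Finset (Finset ι)} (hcov : Covers loc K F) :
    fill W F \ esing loc K (fill W F) ∪ esing loc K F = F := by
  rw [esing_fill hcov]
  ext X
  simp only [mem_union, mem_sdiff, mem_fill, not_or]
  constructor
  · rintro (⟨hX | ⟨c, hc, rfl⟩, hXE, hXim⟩ | hXE)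
    · exact hX
    · exact (hXim (mem_image_of_mem _ hc)).elim
    · exact esing_subset F hXE
  · intro hX
    by_cases hXE : X ∈ esing loc K F
    · exact Or.inr hXE
    · refine Or.inl ⟨Or.inl hX, hXE, fun hXim => ?_⟩
      obtain ⟨c, hc, rfl⟩ := mem_image.1 hXim
      exact (mem_uncovered.1 hc).2 {c} hX (mem_singleton_self c)

/-- **the activity product of a filling, its expandable blocks expanded** (*"we write g₃(∅,X_β) = 1 + g₃′(∅,X_β)"*):
`Π_{X∈P} g(H(X),X) = Σ_{T ⊆ E(P)} Π_{X ∈ (P∖E(P)) ∪ T} g′(H(X),X)`. [cite: BalabanImbrieJaffe1988, p.309 (Sect. 5.14)] -/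
theorem prod_eq_sum_esing (g : Finset S → Finset ι → R) (P : Finset (Finset ι)) :
    ∏ X ∈ P, g (slotsIn loc K X) X =
      ∑ T ∈ (esing loc K P).powerset, ∏ X ∈ P \ esing loc K P ∪ T, prime g (slotsIn loc K X) X := by
  have hsplit : ∏ X ∈ P, g (slotsIn loc K X) X =
      (∏ X ∈ P \ esing loc K P, g (slotsIn loc K X) X) * ∏ X ∈ esing loc K P, g (slotsIn loc K X) X := by
    rw [← prod_union sdiff_disjoint, sdiff_union_of_subset (esing_subset P)]
  have hoff : ∏ X ∈ P \ esing loc K P, g (slotsIn loc K X) X = ∏ X ∈ P \ esing loc K P, prime g (slotsIn loc K X) X := by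
    refine prod_congr rfl fun X hX => (prime_of_not g fun h => (mem_sdiff.1 hX).2 (mem_esing.2 ⟨(mem_sdiff.1 hX).1, h.2, h.1⟩)).symm
  have hon : ∏ X ∈ esing loc K P, g (slotsIn loc K X) X = ∑ T ∈ (esing loc K P).powerset, ∏ X ∈ T, prime g (slotsIn loc K X) X := by
    rw [← prod_one_add]
    exact prod_congr rfl fun X hX => eq_one_add_prime g ⟨(mem_esing.1 hX).2.2, (mem_esing.1 hX).2.1⟩
  rw [hsplit, hoff, hon, mul_sum]
  refine sum_congr rfl fun T hT => ?_
  rw [prod_union (disjoint_of_subset_right (mem_powerset.1 hT) sdiff_disjoint)]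

variable (loc K)

/-- **DROP THE PRIME** (p. 309 [PDF 53], verbatim: *"If |X_β| = 1, H_β = ∅, we write g₃(∅,X_β) = 1 + g₃′(∅,X_β) and the above expansion holds again,
but without the condition that {X_β} fill Λ^{(k)}_{12}. The {X_β} must cover all cubes connected with the (d/dt)_{γ_j}, j ∈ H. Let us drop the
prime"*) — PROVED for every activity `g(H, X)` and every constraint `C` on the families that does not see one-cube polymers (`hC`): the sum over
the `C`-fillings `P` of `W` of `Π_{X∈P} g(H(X), X)` equals the sum over the nonoverlapping `C`-families `F` COVERING the slots of
`Π_{X∈F} g′(H(X), X)`, `g′ = prime g`, `H(X) = slotsIn loc K X` (the slots being located in `W`, `hK`). Bijection `(P, T ⊆ E(P)) ↦ (P ∖ E(P)) ∪ T`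
with inverse `F ↦ (fill F, E(F))`. [cite: BalabanImbrieJaffe1988, p.309 (Sect. 5.14)] -/
theorem dropPrime {W : Finset ι} (C : Finset (Finset ι) → Prop) [DecidablePred C]
    (hC : ∀ F G : Finset (Finset ι), (∀ X ∈ G, X.card = 1) → (C (F ∪ G) ↔ C F))
    (g : Finset S → Finset ι → R) (hK : ∀ j ∈ K, loc j ∈ W) :
    ∑ P ∈ (setPartitions W).filter C, ∏ X ∈ P, g (slotsIn loc K X) X =
      ∑ F ∈ (nonoverlapping W).filter (fun F => C F ∧ Covers loc K F), ∏ X ∈ F, prime g (slotsIn loc K X) X := by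
  have hEs : ∀ F : Finset (Finset ι), ∀ X ∈ esing loc K F, X.card = 1 := fun F X hX => (mem_esing.1 hX).2.1
  rw [sum_congr rfl fun P _ => prod_eq_sum_esing (loc := loc) (K := K) g P, sum_sigma']
  refine sum_nbij' (fun x => x.1 \ esing loc K x.1 ∪ x.2) (fun F => ⟨fill W F, esing loc K F⟩) ?_ ?_ ?_ ?_ ?_
  · -- forward map lands in the covering nonoverlapping `C`-families
    rintro ⟨P, T⟩ hx
    obtain ⟨hP, hT⟩ := mem_sigma.1 hx
    obtain ⟨hP, hCP⟩ := mem_filter.1 hP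
    have hPp : IsSetPartition W P := mem_setPartitions.1 hP
    have hT' : T ⊆ esing loc K P := mem_powerset.1 hT
    have hsub : P \ esing loc K P ∪ T ⊆ P := union_subset sdiff_subset (hT'.trans (esing_subset P))
    refine mem_filter.2 ⟨mem_nonoverlapping_of_subset (mem_nonoverlapping_of_isSetPartition hPp) hsub, ?_, fun j hj => ?_⟩
    · show C (P \ esing loc K P ∪ T)
      have h := hC (P \ (esing loc K P \ T)) (esing loc K P \ T) fun X hX => hEs P X (mem_sdiff.1 hX).1
      rw [sdiff_union_of_subset (sdiff_subset.trans (esing_subset P))] at h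
      rw [sdiff_esing_union hT']
      exact h.1 hCP
    · obtain ⟨X, hXP, hjX⟩ := hPp.exists_mem (hK j hj)
      refine ⟨X, mem_union_left _ (mem_sdiff.2 ⟨hXP, fun hXE => ?_⟩), hjX⟩
      have h0 := (mem_esing.1 hXE).2.2
      exact notMem_empty j (h0 ▸ mem_slotsIn.2 ⟨hj, hjX⟩)
  · -- backward map lands in the fillings with a sub-family of expandable blocks
    intro F hF
    obtain ⟨hF, hCF, hcov⟩ := mem_filter.1 hF
    refine mem_sigma.2 ⟨mem_filter.2 ⟨mem_setPartitions.2 (isSetPartition_fill hF), ?_⟩, mem_powerset.2 (esing_mono (subset_fill W F))⟩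
    exact (hC F _ fun X hX => by obtain ⟨c, -, rfl⟩ := mem_image.1 hX; exact card_singleton c).2 hCF
  · rintro ⟨P, T⟩ hx
    obtain ⟨hP, hT⟩ := mem_sigma.1 hx
    have hPp : IsSetPartition W P := mem_setPartitions.1 (mem_filter.1 hP).1
    have hT' : T ⊆ esing loc K P := mem_powerset.1 hT
    exact Sigma.ext (fill_sdiff_esing_union hPp hT') (heq_of_eq (esing_sdiff_esing_union hT'))
  · intro F hF
    obtain ⟨-, -, hcov⟩ := mem_filter.1 hF
    exact fill_sdiff_esing_fill_union hcov
  · exact fun _ _ => rfl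

/-- **drop the prime, cluster configurations** (the fillings of (5.13.4)/(5.14.3)): admissibility does not see one-cube polymers.
[cite: BalabanImbrieJaffe1988, p.309 (Sect. 5.14)] -/
theorem dropPrime_admissible (adj : ι → ι → Prop) [DecidableRel adj] {W : Finset ι} (g : Finset S → Finset ι → R) (hK : ∀ j ∈ K, loc j ∈ W) :
    ∑ P ∈ (setPartitions W).filter (IsAdmissible adj), ∏ X ∈ P, g (slotsIn loc K X) X =
      ∑ F ∈ (nonoverlapping W).filter (fun F => IsAdmissible adj F ∧ Covers loc K F), ∏ X ∈ F, prime g (slotsIn loc K X) X := by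
  refine dropPrime loc K (IsAdmissible adj) (fun F G hG => ⟨fun h X hX X' hX' => h X (mem_union_left G hX) X' (mem_union_left G hX'),
    fun h X hX X' hX' hne h2 h2' => ?_⟩) g hK
  rcases mem_union.1 hX with hX | hX
  · rcases mem_union.1 hX' with hX' | hX'
    · exact h X hX X' hX' hne h2 h2'
    · have := hG X' hX'; omega
  · have := hG X hX; omega

/-- **drop the prime, all set partitions** (no constraint). [cite: BalabanImbrieJaffe1988, p.309 (Sect. 5.14)] -/
theorem dropPrime_all {W : Finset ι} (g : Finset S → Finset ι → R) (hK : ∀ j ∈ K, loc j ∈ W) :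
    ∑ P ∈ setPartitions W, ∏ X ∈ P, g (slotsIn loc K X) X =
      ∑ F ∈ (nonoverlapping W).filter (Covers loc K), ∏ X ∈ F, prime g (slotsIn loc K X) X := by
  have h := dropPrime loc K (fun _ : Finset (Finset ι) => True) (fun _ _ _ => Iff.rfl) g hK
  rw [filter_true_of_mem fun _ _ => trivial] at h
  rw [h]
  exact sum_congr (filter_congr fun _ _ => by simp only [true_and]) fun _ _ => rfl

end DropPrime

/-! ## §4 (5.14.3) in the prime-dropped form, and summed over the Mayer data -/

section Assembly

variable [DecidableEq S] {adj : ι → ι → Prop} [DecidableRel adj] {R : Type*} [CommRing R] {loc : S → ι}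

/-- **(5.14.3) WITHOUT THE FILLING CONDITION** (p. 309: *"the above expansion holds again, but without the condition that {X_β} fill Λ^{(k)}_{12}.
The {X_β} must cover all cubes connected with the (d/dt)_{γ_j}, j ∈ H. Let us drop the prime"*): for slot-local cluster-factorizing data,
`⟨Π_{j∈K}(d/dt)_{γ_j} Π_{i∈W} f(□_i)⟩_1 = Σ_{F nonoverlapping cluster families covering the slots} Π_{X∈F} g₃′(H(X), X)`.
[cite: BalabanImbrieJaffe1988, (5.14.3) p.309] -/
theorem expansion5143_dropPrime {z : Finset S → Finset ι → Finset ι → R} {K : Finset S} (hz : IsClusterFactorizing adj (z K))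
    (hloc : IsSlotLocal loc z) {W : Finset ι} (hK : ∀ j ∈ K, loc j ∈ W) :
    z K W W = ∑ F ∈ (nonoverlapping W).filter (fun F => IsAdmissible adj F ∧ Covers loc K F),
      ∏ X ∈ F, prime (g3 adj z) (slotsIn loc K X) X := by
  rw [expansion5143 hz hloc W, dropPrime_admissible loc K adj (g3 adj z) hK]

end Assembly

/-! ## §5 Summed over the Mayer data: *"The partition {□_i} of Λ₁₂ is determined by the sets Y from e^{−tV(Y)} − 1 factors, and by sets Y from
V(Y) factors differentiated down"* — the exchange of (5.13.4) with the slot-labelled activities -/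

section TwoSpecies

variable (adj : ι → ι → Prop) [DecidableRel adj] {R : Type*} [CommRing R] (J₀ Ys : Finset (Finset ι)) (W : Finset ι)
  (loc : S → ι)

/-- the local elementary regions of a polymer fill it (whatever the inner Mayer data). [cite: BalabanImbrieJaffe1988, p.304 (Sect. 5.13)] -/
theorem biUnion_localI (X : Finset ι) (T : Finset (Finset ι)) : (localI J₀ X T).biUnion id = X :=
  (isSetPartition_regions _ X).biUnion_id

/-- **the slot-labelled two-species activity** at the level of the cubes: for a cube polymer `X` with inner Mayer data `T`, the printed `g₁` (in
corner form, for the abutting of regions) of the corner data carrying the slot set `H`, on the local elementary regions of `X` — the `g X T` of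
`BIJ88Eq5134TwoSpecies.eq5134_right` with the additional observables of p. 309. [cite: BalabanImbrieJaffe1988, (5.14.3) p.309] -/
def g3r (z : Finset S → Finset (Finset ι) → Finset (Finset ι) → Finset (Finset ι) → R) (H : Finset S) (X : Finset ι)
    (T : Finset (Finset ι)) : R :=
  g1 (radj adj) (z H T) (localI J₀ X T)

variable {adj J₀ Ys W loc}

/-- **(5.14.3) SUMMED OVER THE MAYER DATA** (p. 309 [PDF 53]: *"The partition {□_i} of Λ^{(k)}_{12} is determined by the sets Y from e^{−tV^{(k)}(Y)} − 1
factors, and by sets Y from V^{(k)}(Y) factors differentiated down. The expansion takes the form … (5.14.3)"*; *"We cluster expand as before"*,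
p. 308): for every Mayer set `S` (the `Y` from the `e^{−tV(Y)} − 1` factors; the differentiated `Y` and the other `S`-independent joins being `J₀`)
let `z H S` be the corner expectations on the sets of elementary regions of `S` carrying the slot set `H`, cluster-factorizing (`hz`), local in the
Mayer data (`hloc`, as in `eq5134_right`) and slot-local through the cube content (`hslot`). Then the `S`-summed left side of (5.14.3) equals the
TWO-SPECIES polymer sum of `BIJ88Eq5134TwoSpecies.exchange5134` (fillings `Q` of the cubes by `J₀`-closed polymers, hard core among the
multi-region ones) with the slot-labelled activities `g3r (H(X)) X T`, `H(X) = slotsIn loc H X` — the honest form of *"Σ_{{X_α} filling Λ₁₂}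
Π_β g₃(H_β, X_β)"* after the Mayer resummation, exactly as for (5.13.4) (`eq5134_right`, the slot set a parameter of the weights).
[cite: BalabanImbrieJaffe1988, (5.14.3) p.309] -/
theorem expansion5143_twoSpecies (hJ₀ : ∀ Y ∈ J₀, Y ⊆ W) (hYs : ∀ Y ∈ Ys, Y.Nonempty)
    (z : Finset S → Finset (Finset ι) → Finset (Finset ι) → Finset (Finset ι) → R) (H : Finset S)
    (hz : ∀ S ⊆ polysIn Ys W, IsClusterFactorizing (radj adj) (z H S))
    (hloc : ∀ S ⊆ polysIn Ys W, ∀ K ⊆ regions (J₀ ∪ S) W, ∀ Λ ⊆ K, z H S K Λ = z H (restrictTo S (K.biUnion id)) K Λ)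
    (hslot : ∀ T K Λ, Λ ⊆ K → z H T K Λ = z (slotsIn loc H (K.biUnion id)) T K Λ) :
    ∑ S ∈ (polysIn Ys W).powerset, z H S (regions (J₀ ∪ S) W) (regions (J₀ ∪ S) W) =
      ∑ Q ∈ (setPartitions W).filter (fun Q => ∀ X ∈ Q, IsClosed J₀ W X),
        ∑ M ∈ Q.powerset.filter (HardCore adj),
          (∏ X ∈ M, gB J₀ Ys (fun X T => g3r adj J₀ z (slotsIn loc H X) X T) X) *
            ∏ X ∈ Q \ M, gA J₀ Ys (fun X T => g3r adj J₀ z (slotsIn loc H X) X T) X := by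
  have hfun : (fun X T => g1 (radj adj) (z H T) (localI J₀ X T)) = fun X T => g3r adj J₀ z (slotsIn loc H X) X T := by
    funext X T
    refine g1_congr (radj adj) fun Λ hΛ => ?_
    rw [hslot T _ Λ hΛ, biUnion_localI]
  rw [← hfun]
  exact eq5134_right adj J₀ Ys W hJ₀ hYs (z H) hz hloc

end TwoSpecies

/-! ## §6 *"Each X_γ must cover and connect all the t-derivatives specified by H_γ"* (p. 309) and the exponent bookkeeping of (5.14.4)

p. 309 [PDF 53], verbatim, after (5.14.4): *"We use X_β∖H_β to denote the set of cubes with no (d/dt)_{γ_j} factors, j ∈ H_β."* and, after the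
last display of the page (the expansion regrouped over *"{X_γ}, {Y_δ} nonoverlapping"*): *"Each X_γ must cover and connect all the t-derivatives
specified by H_γ."*  In the bookkeeping of §1–§4: COVER is the
definition of `H_β = slotsIn loc K X_β` (`loc_mem_of_mem_slotsIn`); CONNECT is the vanishing of the printed activity `g₁` — hence of `g₃(H,X)` and of
the prime-dropped `g₃` — on every polymer of at least two cubes that is not connected under abutting (`BIJ88PolymerRep5134.g1_of_two_le`), so that
(5.14.3) and its prime-dropped form may be summed over families of CONNECTED polymers only (`expansion5143_conn`, `expansion5143_dropPrime_conn`);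
the set `X_β∖H_β` of (5.14.4) is `X ∖ loc(H_β) = X ∖ loc(K)` (`sdiff_image_slotsIn`), and over a filling the `|H_β|` add up to the number of
slots (`sum_card_slotsIn`, the `Σ_β|H_β| = n̄+1` of the p. 310 estimate). v1.1, theorem-only append. -/

section CoverConnect

variable {adj : ι → ι → Prop} [DecidableRel adj] {R : Type*} [CommRing R] {loc : S → ι} {K : Finset S}

/-- **COVER**: every slot of `H_β = slotsIn loc K X_β` is located in `X_β`. [cite: BalabanImbrieJaffe1988, p.309 (Sect. 5.14)] -/
theorem loc_mem_of_mem_slotsIn {X : Finset ι} {j : S} (hj : j ∈ slotsIn loc K X) : loc j ∈ X := (mem_slotsIn.1 hj).2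

/-- **CONNECT**: `g₃(H, X) = 0` for every polymer `X` of at least two cubes that is not connected (whatever the slot set `H`).
[cite: BalabanImbrieJaffe1988, p.309 (Sect. 5.14)] -/
theorem g3_eq_zero_of_not_isConn (z : Finset S → Finset ι → Finset ι → R) (H : Finset S) {X : Finset ι} (h2 : 2 ≤ X.card)
    (hX : ¬ IsConn adj X) : g3 adj z H X = 0 := by
  rw [g3, g1_of_two_le adj (z H) h2, if_neg hX]

/-- a nonempty polymer with `g₃(H, X) ≠ 0` is connected. [cite: BalabanImbrieJaffe1988, p.309 (Sect. 5.14)] -/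
theorem isConn_of_g3_ne_zero (z : Finset S → Finset ι → Finset ι → R) (H : Finset S) {X : Finset ι} (hX : X.Nonempty)
    (h : g3 adj z H X ≠ 0) : IsConn adj X := by
  by_contra hc
  rcases Nat.lt_or_ge X.card 2 with hlt | hge
  · have h1 : X.card = 1 := by have := hX.card_pos; omega
    obtain ⟨c, rfl⟩ := card_eq_one.1 h1
    exact hc (isConn_singleton adj c)
  · exact h (g3_eq_zero_of_not_isConn z H hge hc)

/-- **(5.14.3) OVER CONNECTED FILLINGS**: *"Each X_γ must … connect"* — the cluster families of (5.14.3) may be restricted to those whose polymers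
are all connected. [cite: BalabanImbrieJaffe1988, (5.14.3) p.309] -/
theorem expansion5143_conn {z : Finset S → Finset ι → Finset ι → R} (hz : IsClusterFactorizing adj (z K)) (hloc : IsSlotLocal loc z)
    (W : Finset ι) :
    z K W W = ∑ P ∈ (setPartitions W).filter (fun P => IsAdmissible adj P ∧ ∀ X ∈ P, IsConn adj X),
      ∏ X ∈ P, g3 adj z (slotsIn loc K X) X := by
  rw [expansion5143 hz hloc W]
  have hf : (setPartitions W).filter (fun P => IsAdmissible adj P ∧ ∀ X ∈ P, IsConn adj X) =
      ((setPartitions W).filter (IsAdmissible adj)).filter fun P => ∀ X ∈ P, IsConn adj X := by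
    rw [filter_filter]
  rw [hf]
  refine (sum_filter_of_ne fun P hP hne X hX => ?_).symm
  have hPp : IsSetPartition W P := (mem_setPartitions.1 (mem_filter.1 hP).1)
  by_contra hc
  exact hne (prod_eq_zero hX (by
    by_contra h
    exact hc (isConn_of_g3_ne_zero z _ (hPp.nonempty_of_mem hX) h)))

variable [DecidableEq S]

/-- **CONNECT, prime dropped**: the prime-dropped activity vanishes on disconnected polymers of at least two cubes as well.
[cite: BalabanImbrieJaffe1988, p.309 (Sect. 5.14)] -/
theorem prime_g3_eq_zero_of_not_isConn (z : Finset S → Finset ι → Finset ι → R) (H : Finset S) {X : Finset ι} (h2 : 2 ≤ X.card)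
    (hX : ¬ IsConn adj X) : prime (g3 adj z) H X = 0 := by
  rw [prime_of_not _ fun h => absurd h.2 (by omega), g3_eq_zero_of_not_isConn z H h2 hX]

/-- a nonempty polymer with nonzero prime-dropped activity is connected. [cite: BalabanImbrieJaffe1988, p.309 (Sect. 5.14)] -/
theorem isConn_of_prime_g3_ne_zero (z : Finset S → Finset ι → Finset ι → R) (H : Finset S) {X : Finset ι} (hX : X.Nonempty)
    (h : prime (g3 adj z) H X ≠ 0) : IsConn adj X := by
  by_contra hc
  rcases Nat.lt_or_ge X.card 2 with hlt | hge
  · have h1 : X.card = 1 := by have := hX.card_pos; omega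
    obtain ⟨c, rfl⟩ := card_eq_one.1 h1
    exact hc (isConn_singleton adj c)
  · exact h (prime_g3_eq_zero_of_not_isConn z H hge hc)

/-- **(5.14.3) PRIME-DROPPED, OVER CONNECTED COVERING FAMILIES**: *"The {X_β} must cover all cubes connected with the (d/dt)_{γ_j}, j ∈ H. … Each
X_γ must cover and connect all the t-derivatives specified by H_γ"* — the nonoverlapping covering cluster families of `expansion5143_dropPrime` may
be restricted to those whose polymers are all connected. [cite: BalabanImbrieJaffe1988, (5.14.3) p.309] -/
theorem expansion5143_dropPrime_conn {z : Finset S → Finset ι → Finset ι → R} (hz : IsClusterFactorizing adj (z K))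
    (hloc : IsSlotLocal loc z) {W : Finset ι} (hK : ∀ j ∈ K, loc j ∈ W) :
    z K W W = ∑ F ∈ (nonoverlapping W).filter (fun F => IsAdmissible adj F ∧ Covers loc K F ∧ ∀ X ∈ F, IsConn adj X),
      ∏ X ∈ F, prime (g3 adj z) (slotsIn loc K X) X := by
  rw [expansion5143_dropPrime hz hloc hK]
  have hf : (nonoverlapping W).filter (fun F => IsAdmissible adj F ∧ Covers loc K F ∧ ∀ X ∈ F, IsConn adj X) =
      ((nonoverlapping W).filter fun F => IsAdmissible adj F ∧ Covers loc K F).filter fun F => ∀ X ∈ F, IsConn adj X := by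
    rw [filter_filter]
    simp only [and_assoc]
  rw [hf]
  refine (sum_filter_of_ne fun F hF hne X hX => ?_).symm
  have hXne : X.Nonempty := ((mem_nonoverlapping.1 (mem_filter.1 hF).1).1 X hX).2
  by_contra hc
  exact hne (prod_eq_zero hX (by
    by_contra h
    exact hc (isConn_of_prime_g3_ne_zero z _ hXne h)))

omit [DecidableEq S] in
/-- **`X_β ∖ H_β` of (5.14.4)** (*"the set of cubes with no (d/dt)_{γ_j} factors, j ∈ H_β"*): with `H_β = slotsIn loc K X_β`, the cubes of `X_β`
carrying no derivative of `H_β` are the cubes of `X_β` carrying no derivative at all. [cite: BalabanImbrieJaffe1988, (5.14.4) p.309] -/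
theorem sdiff_image_slotsIn (K : Finset S) (X : Finset ι) : X \ (slotsIn loc K X).image loc = X \ K.image loc := by
  ext c
  simp only [mem_sdiff, mem_image, mem_slotsIn, not_exists, not_and]
  constructor
  · rintro ⟨hc, h⟩
    exact ⟨hc, fun j hj hjc => h j ⟨hj, hjc ▸ hc⟩ hjc⟩
  · rintro ⟨hc, h⟩
    exact ⟨hc, fun j hj hjc => h j hj.1 hjc⟩

omit [DecidableEq S] in
/-- the cubes of `X_β` split into those carrying a derivative of `H_β` and `X_β ∖ H_β`: `|X_β| = |X_β ∩ loc(K)| + |X_β ∖ loc(K)|`.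
[cite: BalabanImbrieJaffe1988, (5.14.4) p.309] -/
theorem card_eq_card_filter_add_card_sdiff (K : Finset S) (X : Finset ι) :
    X.card = (X.filter fun c => c ∈ K.image loc).card + (X \ K.image loc).card := by
  rw [← card_filter_add_card_filter_not fun c => c ∈ K.image loc, sdiff_eq_filter]

/-- **`Σ_β |H_β| = |K|`** over a filling of a region containing all the slots (the exponent count behind the p. 310 bound
`(…)^{n̄+1+β′|X|}`). [cite: BalabanImbrieJaffe1988, p.310 (Sect. 5.14)] -/
theorem sum_card_slotsIn {W : Finset ι} {P : Finset (Finset ι)} (hP : IsSetPartition W P) (hK : ∀ j ∈ K, loc j ∈ W) :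
    ∑ X ∈ P, (slotsIn loc K X).card = K.card := by
  rw [← card_biUnion fun X hX Y hY hne => disjoint_slotsIn (hP.disjoint hX hY hne), biUnion_slotsIn_of_isSetPartition hP]
  congr 1
  exact filter_true_of_mem hK

/-- over a nonoverlapping COVERING family the `|H_β|` also add up to `|K|`. [cite: BalabanImbrieJaffe1988, p.310 (Sect. 5.14)] -/
theorem sum_card_slotsIn_of_covers {W : Finset ι} {F : Finset (Finset ι)} (hF : F ∈ nonoverlapping W) (hcov : Covers loc K F) :
    ∑ X ∈ F, (slotsIn loc K X).card = K.card := by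
  rw [← card_biUnion fun X hX Y hY hne => disjoint_slotsIn ((mem_nonoverlapping.1 hF).2 X hX Y hY hne), biUnion_slotsIn]
  congr 1
  refine filter_true_of_mem fun j hj => ?_
  obtain ⟨X, hX, hjX⟩ := hcov j hj
  exact mem_biUnion.2 ⟨X, hX, hjX⟩

end CoverConnect

end Literature.MathematicalPhysics.QuantumFieldTheory.BalabanImbrieJaffe1984to88.BIJ88Expansion5143
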